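import Literature.MathematicalPhysics.QuantumFieldTheory.Balaban1983to89.B9Thm311InverseL2BoundsZdPer
import Literature.MathematicalPhysics.QuantumFieldTheory.Balaban1983to89.B9Eq325QprimeStarLowerBoundZd
import Literature.MathematicalPhysics.QuantumFieldTheory.Balaban1983to89.B9Eq324DeltaPrimeUpperBoundZd

/-!
# `Balaban1983to89.B9Eq325QGGQCoerciveExplicitZdPer` — [Balaban1985BackgroundPropagators] (3.25) p. 394 ∕ Thm 3.11 p. 416 («the operators Δ′_a, G′, Q′G′²Q′*, (Q′G′²Q′*)⁻¹
# … are positive definite … uniformly in U») IN QUANTITATIVE CURRENCY ON THE TORUS `T_P` READ ON `ℤᵈ`: the UPPER bound `⟨f, Δ′_a(U₀)f⟩ ≤ Θ⟨f, f⟩`, `Θ = 4d∕η² + Σ_{j≤m} a_j`,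
# and `‖Δ′_a(U₀)f‖² ≤ Θ²‖f‖²` on `L²(T_P)`; hence `‖G′(U₀)v‖ ≥ Θ⁻¹‖v‖`; the EXACT isometry `⟨Q′*φ, Q′*φ⟩_{T_P} = (Lᵈ)^{−j₀}⟨φ, φ⟩_{𝔅_P}` at the torus members (one
# active level `j₀`); and therefore an EXPLICIT coercivity constant for the third operator of (3.25), `c″ = ((Lᵈ)^{j₀}·Θ²)⁻¹`:
# `c″⟨φ, φ⟩_{𝔅_P} ≤ ⟨φ, Q′G′(U₀)²Q′*φ⟩_{𝔅_P}` at EVERY unitary periodic background of the scalar regime whose averaged transporters are unitary up to level `m`,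
# with the bound `⟨cφ, cφ⟩ ≤ c″⁻²⟨φ, φ⟩` for `c = (Q′G′²Q′*)⁻¹` — the periodic twin of this lineage's `B9Eq325QGGQCoerciveExplicitZd`

statement-level skeleton of published theorems with citation tags; proofs where landed; nothing here is a claim about the
Yang–Mills mass gap

`[Balaban1985BackgroundPropagators]` ("B9", CMP **99** (1985) 389–434) p. 394 (3.25) (*«… if Δ′_a, Q′G′²Q′* are invertible. It will be proved later»*), (3.23)–(3.24)
p. 394, (3.18)–(3.19) p. 393; Thm 3.11 p. 416.  `[Balaban1984PropagatorsII]` p. 226, (2.22) («bounded from below … hence the inverse is bounded»).  `[Balaban1985Averaging]`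
Prop. 2 p. 26 (unitary averaged transporters).  `[Balaban1985RegularSpaces]` p. 77 *«Ω_j = T_η»*, (1.28) p. 81, (1.131) p. 99.  PDF held:
`paper:balaban1985-cmp99-background-propagators` pp. 393–394, 416 (re-read by this seat, 2026-08-28).

CITATION HEADER (lean-in-tree rule).  Cell `pub-ymgap` (YM Track A, HUMAN RULING D-0062 ∕ D-0149 width push), DAG node N06 = [B9], width seat `pub-ymgap-dag-n06-w4`
(g6), the (β′-PERIODIC) road.  WHY: with `B9Thm31NearFlatCoerciveClassZdPer` (Δ′_a coercive on the class) and `B9Thm311InverseL2BoundsZdPer` (G′ bounded) the two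
remaining operators of (3.25) — `Q′G′²Q′*` and its inverse `c(U₀)` — get explicit constants here, so that ALL FOUR operators of print's formula for `R(U₀)` on the torus
are quantitatively controlled at every background of the scalar regime (in particular of the small-field class).  Stencil facts are imported BY NAME: `fnorm_trIter`
(dag-n06-w4 g5's `B9Eq325QprimeStarLowerBoundZd`), `fnorm_covDerivFwd_sq_le` (g4's `B9Eq324DeltaPrimeUpperBoundZd`), `QprimeIter_eq_blockSum_trIter_fun`, the cell
tilings, the levels editions; the abstract Cauchy–Schwarz `sq_le_mul_of_symm_nonneg` (g4); nothing re-declared.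

WHAT IS PROVED (kernel, 0 sorry; theorems only — no `def`, no `instance`, no `notation`).
* §1 `fnorm_QprimeIter_sq_le_blockSum` (`|Q′_j(U₀)F(y)|²_τ ≤ (Lᵈ)^{−j}·Σ_{x∈Bʲ(y)}|F(x)|²_τ`, transporters unitary below `j`) · `fnorm_qprimeT1_eq` · `fnorm_QprimeT_eq`
  (`|Q′_jᵀν(x)|_τ = (Lᵈ)^{−j}|ν(blockMap^j x)|_τ`) · `QprimeT_zero_fun`.
* §2 ★★ `formPer_deltaPrimeAPer_self_le` (THE UPPER FORM BOUND `⟨f, Δ′_a(U₀)f⟩_{T_P} ≤ Θ·⟨f, f⟩_{T_P}`, `Θ = 4d∕η² + Σ_{j≤m} a_j`, at a unitary periodic `U₀` with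
  `Ū₀ʲ(Γ)` unitary for `j ≤ m`, `Lᵐ ∣ P`, `a ≥ 0`, `1 ≤ L`) · ★★ `formPer_deltaPrimeAPer_sq_le` (`⟨Δ′_af, Δ′_af⟩ ≤ Θ²⟨f, f⟩` — the OPERATOR bound, by Cauchy–Schwarz for
  the form `⟨u, Δ′_a v⟩`) · ★ `formPer_self_le_sq_mul_formPer_GpPer` (`⟨v, v⟩ ≤ Θ²⟨G′v, G′v⟩` in the regime).
* §3 ★★ `formPer_QprimeStarPer_self_eq_of_single_level` (THE ISOMETRY `⟨Q′*φ, Q′*φ⟩_{T_P} = (Lᵈ)^{−j₀}·⟨φ, φ⟩_{𝔅_P}` when `Λ_j` is empty at the representatives for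
  `j ≠ j₀` — the torus members' geometry — and `Ū₀ʲ(Γ)` is unitary for `j < j₀`).
* §4 ★★★ `coercive_levFormPer_qggqPer_explicit` (`((Lᵈ)^{j₀}Θ²)⁻¹·⟨φ, φ⟩_{𝔅_P} ≤ ⟨φ, Q′G′(U₀)²Q′*φ⟩_{𝔅_P}` in the regime `RegularPrimePer`, one active level, unitary
  periodic `U₀`, `Ū₀ʲ(Γ)` unitary for `j ≤ m`), ★★ `levFormPer_cPer_self_le_explicit` (`⟨cφ, cφ⟩ ≤ ((Lᵈ)^{j₀}Θ²)²·⟨φ, φ⟩`), ★★ `coercive_levFormPer_qggqPer_torusLam`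
  (the torus member's classes `torusLam m`: `j₀ = m`, no geometric hypothesis).
* §5 ★★★ `coercive_levFormPer_qggqPer_of_class` (at EVERY background of the small-field class of the torus — `‖U₀(b) − 1‖ ≤ θ′η`, `pdev U₀ < α₀L^{−2k}`, `m ≤ k`, weights, flat
  coercivity, positive margin — the regime and the transporters' unitarity are DISCHARGED (`regularPrimePer_of_class`, [B7] Prop. 2): no regime hypothesis left).

HONEST SCOPE.  (i) Explicit `L²_τ` constants only; no decay; scalar letters `Δ′_a, G′, Q′G′²Q′*, c` (not the vector `Δ_a, G` of the record).  (ii) The regime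
`RegularPrimePer` is a hypothesis of §4 (a THEOREM on the small-field class by `B9Thm31NearFlatCoerciveClassZdPer.regularPrimePer_of_class`, and near `1` by
`B9Thm311PosDefOpenZdPer.regularPrimePer_eventually_one`).  (iii) Count-neutral; N05 ∕ N06 NOT discharged; K1⁹ `stmt-QuantumFields-27364` NOT closed; one finite `𝕋⁴`
programme at fixed `ε`, Bałaban as printed; R4 closes only the conditional finite-`𝕋⁴` rung `BalabanLadder.UV` — nothing continuum ∕ ℝ⁴ ∕ OS ∕ mass gap ∕ Clay.  Unit
`pub-ymgap-dag-n06-w4` (g6), 2026-08-28.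
-/

noncomputable section

namespace Literature.MathematicalPhysics.QuantumFieldTheory.Balaban1983to89.B9Eq325QGGQCoerciveExplicitZdPer

open B7Prop1Explicit
open B7Eq78Linearization (conjR QprimeIter zdBlocking)
open B7Prop2Explicit (unitaryUnits)
open B8Ineq132 (covDerivFwd)
open B8Eq119TwistedAxial (bgT)
open B8Eq138LandauZd (qprimeT1 QprimeT QT)
open Literature.MathematicalPhysics.QuantumLattice (blockMap blockSites card_blockSites)
open T4TermwiseTorus (IsPeriodic box)
open B9Eq321LandauProjectionZdPer (perSub formPer formPer_apply formPer_isSymm formPer_apply_self_eq_zero)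
open B9Eq321LandauOrthogonalZdPer (box_mul_eq_biUnion_blockSites box_eq_biUnion_blockSites_of_dvd pairwiseDisjoint_blockSites)
open B9Eq321LandauMultiplierIffZdPer (eq_pow_mul_div_of_dvd)
open B9Eq324DeltaPrimeAZdPer (deltaPrimeAPer RegularPrimePer GpPer deltaPrimeAPer_GpPer GpPer_deltaPrimeAPer)
open B9Eq325QGGQInvZdPer (InSat levPer levFormPer levFormPer_apply QprimeVecPer QprimeStarPer QprimeStarPer_coe_apply_of_mem_box qggqPer
  QprimeStarPerInjective cPer qprimeStarPerInjective_of_single_level neZero_div_pow)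
open B9Eq325QGGQInvZdPerLevels (formPer_deltaPrimeAPer_le formPer_deltaPrimeAPer_symm_le formPer_deltaPrimeAPer_self_nonneg_le levFormPer_qggqPer_self_le
  qggqPer_bijective_le)
open B9Eq325QprimeSingleSiteZd (blockMapIter blockMapIter_zero blockMapIter_succ trIter)
open B9Eq319QQStarDiagonalZd (mem_blockSites_pow_iff)
open B9Eq342CombesThomasFormZd (fnorm fnorm_nonneg fnorm_sq fnorm_smul fnorm_zero fnorm_sum_le)
open B9Thm31GpDecayOfCoerciveZd (fnorm_conjR_of_unitary)
open B9Eq324NearFlatFormComparisonZdPer (QprimeIter_eq_blockSum_trIter_fun)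
open B9Eq325QprimeStarLowerBoundZd (fnorm_trIter)
open B9Eq324DeltaPrimeUpperBoundZd (fnorm_covDerivFwd_sq_le)
open B9Eq327GreenZdHermPer (sum_box_shift)
open B9Thm311InverseL2BoundsZd (sq_le_mul_of_symm_nonneg)
open B9Thm311InverseL2BoundsZdPer (formPer_self_nonneg' levFormPer_cPer_self_le_of_coercive)

-- `Site` alone could resolve to the torus sites of `Setup.lean`; re-export the `ℤ^d` sites of `B7Prop1Explicit`.
export B7Prop1Explicit (Site)

variable {d : ℕ} {𝔸 : Type*} [CStarAlgebra 𝔸]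
variable (τ : 𝔸 →ₗ[ℂ] ℂ) (hτp : ∀ a : 𝔸, a ≠ 0 → 0 < (τ (star a * a)).re)
  (hτt : ∀ a b : 𝔸, τ (a * b) = τ (b * a)) (hτs : ∀ a : 𝔸, τ (star a) = starRingEnd ℂ (τ a))

/-! ## §1  Block bounds for `Q′_j(U₀)` and the weighted isometry `Q′_jᵀ` -/

section Stencils

variable {L : ℕ} [NeZero L] {U₀ : Site d → Fin d → 𝔸ˣ}

include hτp hτt hτs in
/-- **`|Q′_j(U₀)F(y)|²_τ ≤ (Lᵈ)^{−j}·Σ_{x∈Bʲ(y)} |F(x)|²_τ`** when the averaged transporters below `j` are unitary (each `|trIter_j x F(x)|_τ = (Lᵈ)^{−j}|F(x)|_τ`, then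
Cauchy–Schwarz over the `(Lᵈ)^j` sites of the block). [cite: Balaban1985BackgroundPropagators, (3.18)–(3.19) p.393, (3.24) p.394; Balaban1985Averaging, Prop. 2 p.26] -/
theorem fnorm_QprimeIter_sq_le_blockSum (F : Site d → 𝔸) {j : ℕ} (hT : ∀ i, i < j → ∀ z y : Site d, bgT L U₀ i z y ∈ unitaryUnits 𝔸) (y : Site d) :
    fnorm τ (QprimeIter (zdBlocking d L) (bgT L U₀) j F y) ^ 2 ≤ (((L : ℝ) ^ d) ^ j)⁻¹ * ∑ x ∈ blockSites (L ^ j) y, fnorm τ (F x) ^ 2 := by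
  classical
  set B := blockSites (L ^ j) y with hB
  set c : ℝ := ((L : ℝ) ^ d)⁻¹ with hc
  have hc0 : 0 ≤ c := by positivity
  have hL0 : (0 : ℝ) < (L : ℝ) := by exact_mod_cast Nat.pos_of_ne_zero (NeZero.ne L)
  have h1 : fnorm τ (QprimeIter (zdBlocking d L) (bgT L U₀) j F y) ≤ c ^ j * ∑ x ∈ B, fnorm τ (F x) := by
    rw [QprimeIter_eq_blockSum_trIter_fun F j y, ← hB]
    refine (fnorm_sum_le hτp hτs _ _).trans ?_
    rw [Finset.mul_sum]
    refine Finset.sum_le_sum fun x _ => ?_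
    rw [fnorm_trIter τ hτt x (F x) j hT, hc]
  have h0 : 0 ≤ fnorm τ (QprimeIter (zdBlocking d L) (bgT L U₀) j F y) := fnorm_nonneg τ _
  have hCS := sq_sum_le_card_mul_sum_sq (s := B) (f := fun x => fnorm τ (F x))
  rw [hB, card_blockSites] at hCS
  push_cast at hCS
  have hcard : (((L : ℝ) ^ j) ^ d) = ((L : ℝ) ^ d) ^ j := by rw [← pow_mul, ← pow_mul, mul_comm]
  rw [hcard] at hCS
  have hcj : c ^ j * ((L : ℝ) ^ d) ^ j = 1 := by rw [hc, inv_pow, inv_mul_cancel₀ (by positivity)]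
  calc fnorm τ _ ^ 2 ≤ (c ^ j * ∑ x ∈ B, fnorm τ (F x)) ^ 2 := pow_le_pow_left₀ h0 h1 2
    _ = (c ^ j) ^ 2 * (∑ x ∈ B, fnorm τ (F x)) ^ 2 := by ring
    _ ≤ (c ^ j) ^ 2 * (((L : ℝ) ^ d) ^ j * ∑ x ∈ B, fnorm τ (F x) ^ 2) := mul_le_mul_of_nonneg_left (by rw [hB]; exact hCS) (by positivity)
    _ = (((L : ℝ) ^ d) ^ j)⁻¹ * ∑ x ∈ B, fnorm τ (F x) ^ 2 := by
        have : (c ^ j) ^ 2 * ((L : ℝ) ^ d) ^ j = (((L : ℝ) ^ d) ^ j)⁻¹ := by rw [sq, mul_assoc, hcj, mul_one, hc, inv_pow]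
        rw [← this, hB]
        ring

omit [NeZero L] in
include hτt in
/-- `|(Q′ᵀν)(y)|_τ = (Lᵈ)⁻¹·|ν(blockMap y)|_τ` for the one-step transpose at a level with unitary transporters. [cite: Balaban1985BackgroundPropagators, (3.19) p.393 (bookkeeping)] -/
theorem fnorm_qprimeT1_eq {j : ℕ} (hT : ∀ z y : Site d, bgT L U₀ j z y ∈ unitaryUnits 𝔸) (ν : Site d → 𝔸) (y : Site d) :
    fnorm τ (qprimeT1 L U₀ j ν y) = ((L : ℝ) ^ d)⁻¹ * fnorm τ (ν (blockMap L y)) := by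
  have hLd : (0 : ℝ) ≤ ((L : ℝ) ^ d)⁻¹ := by positivity
  rw [qprimeT1, fnorm_smul, fnorm_conjR_of_unitary τ hτt ((unitaryUnits 𝔸).inv_mem (hT _ y)), abs_of_nonneg hLd]

omit [NeZero L] in
include hτt in
/-- ★ **THE ITERATED TRANSPOSE IS A WEIGHTED ISOMETRY ON THE FIBRES: `|(Q′_jᵀν)(x)|_τ = (Lᵈ)^{−j}·|ν(blockMap^j x)|_τ`** (transporters unitary below `j`).
[cite: Balaban1985BackgroundPropagators, (3.19) p.393, (3.24) p.394; Balaban1985Averaging, Prop. 2 p.26] -/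
theorem fnorm_QprimeT_eq : ∀ (j : ℕ) (_ : ∀ i, i < j → ∀ z y : Site d, bgT L U₀ i z y ∈ unitaryUnits 𝔸) (ν : Site d → 𝔸) (x : Site d),
    fnorm τ (QprimeT L U₀ j ν x) = (((L : ℝ) ^ d)⁻¹) ^ j * fnorm τ (ν (blockMapIter L j x)) := by
  intro j
  induction j with
  | zero => intro _ ν x; simp [QprimeT, blockMapIter_zero]
  | succ j ih =>
    intro hT ν x
    show fnorm τ (QprimeT L U₀ j (qprimeT1 L U₀ j ν) x) = _
    rw [ih (fun i hi => hT i (Nat.lt_succ_of_lt hi)) (qprimeT1 L U₀ j ν) x, fnorm_qprimeT1_eq τ hτt (hT j (Nat.lt_succ_self j)) ν,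
      blockMapIter_succ, pow_succ]
    ring

omit [NeZero L] in
/-- `Q′_jᵀ 0 = 0` (linearity bookkeeping). [cite: Balaban1985BackgroundPropagators, (3.19) p.393 (bookkeeping)] -/
theorem QprimeT_zero_fun : ∀ (j : ℕ) (x : Site d), QprimeT L U₀ j (fun _ => (0 : 𝔸)) x = 0 := by
  intro j
  induction j with
  | zero => intro x; rfl
  | succ j ih =>
    intro x
    show QprimeT L U₀ j (qprimeT1 L U₀ j fun _ => (0 : 𝔸)) x = 0
    have h0 : (qprimeT1 L U₀ j fun _ => (0 : 𝔸)) = fun _ => (0 : 𝔸) := by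
      funext y
      rw [qprimeT1, conjR, mul_zero, zero_mul, smul_zero]
    rw [h0]
    exact ih x

end Stencils

/-! ## §2  The upper form bound `⟨f, Δ′_a(U₀)f⟩ ≤ Θ⟨f, f⟩` and the operator bound `‖Δ′_a(U₀)f‖² ≤ Θ²‖f‖²` on `L²(T_P)` -/

section Upper

variable {P L : ℕ} [NeZero P] [NeZero L] {η : ℝ} {U₀ : Site d → Fin d → 𝔸ˣ} {m : ℕ} {a : ℕ → ℝ} {Λs : ℕ → Set (Site d)}

include hτp hτt hτs in
/-- ★★ **THE UPPER FORM BOUND ON THE TORUS: `⟨f, Δ′_a(U₀)f⟩_{T_P} ≤ Θ·⟨f, f⟩_{T_P}`, `Θ = 4d∕η² + Σ_{j≤m} a_j`** — at a unitary `P`-periodic `U₀` with `Ū₀ʲ(Γ)` unitary for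
`j ≤ m`, `Lᵐ ∣ P`, `a ≥ 0`, `1 ≤ L`: the gradient energy is `≤ (4d∕η²)‖f‖²` (`|D_μf(x)|² ≤ 2η⁻²(|f(x+e_μ)|² + |f(x)|²)` and the shifted cell sum of a periodic function is
the cell sum), the level-`j` penalty is `≤ a_j(Lᵈ)^{−j}‖f‖² ≤ a_j‖f‖²` (block Cauchy–Schwarz, the blocks tile the cell).
[cite: Balaban1985BackgroundPropagators, (3.23)–(3.24) p.394, Thm 3.11 p.416; Balaban1985RegularSpaces, (1.1) p.76, p.77 («Ω_j = T_η»)] -/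
theorem formPer_deltaPrimeAPer_self_le (hL : 1 ≤ L) (hUu : ∀ (x : Site d) (κ : Fin d), U₀ x κ ∈ unitaryUnits 𝔸)
    (hT : ∀ j, j ≤ m → ∀ (z y : Site d), bgT L U₀ j z y ∈ unitaryUnits 𝔸) (hU : IsPeriodic P U₀) (hP : L ^ m ∣ P) (ha : ∀ j, 0 ≤ a j)
    (f : perSub (𝔸 := 𝔸) (d := d) P) :
    formPer τ P f (deltaPrimeAPer L U₀ η m a Λs P f) ≤ (4 * (d : ℝ) * (η ^ 2)⁻¹ + ∑ j ∈ Finset.range (m + 1), a j) * formPer τ P f f := by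
  classical
  set F : Site d → 𝔸 := (f : Site d → 𝔸) with hF
  have hff : formPer τ P f f = ∑ x ∈ box (d := d) P, fnorm τ (F x) ^ 2 := by
    rw [formPer_apply]
    exact Finset.sum_congr rfl fun x _ => (fnorm_sq hτp _).symm
  have hffnn : 0 ≤ formPer τ P f f := by rw [hff]; exact Finset.sum_nonneg fun _ _ => sq_nonneg _
  rw [formPer_deltaPrimeAPer_le τ hτt hUu hT hU hP f f]
  -- gradient energy
  have hgrad : ∑ μ : Fin d, ∑ x ∈ box (d := d) P, (τ (star (covDerivFwd η U₀ μ F x) * covDerivFwd η U₀ μ F x)).re ≤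
      4 * (d : ℝ) * (η ^ 2)⁻¹ * formPer τ P f f := by
    have hμ : ∀ μ : Fin d, ∑ x ∈ box (d := d) P, (τ (star (covDerivFwd η U₀ μ F x) * covDerivFwd η U₀ μ F x)).re ≤ 4 * (η ^ 2)⁻¹ * formPer τ P f f := by
      intro μ
      have hshift : ∑ x ∈ box (d := d) P, fnorm τ (F (x + e μ)) ^ 2 = ∑ x ∈ box (d := d) P, fnorm τ (F x) ^ 2 :=
        sum_box_shift P (g := fun x => fnorm τ (F x) ^ 2) (fun x n => congrArg (fun b : 𝔸 => fnorm τ b ^ 2) (f.2 x n)) (e μ)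
      calc ∑ x ∈ box (d := d) P, (τ (star (covDerivFwd η U₀ μ F x) * covDerivFwd η U₀ μ F x)).re
          = ∑ x ∈ box (d := d) P, fnorm τ (covDerivFwd η U₀ μ F x) ^ 2 := Finset.sum_congr rfl fun x _ => (fnorm_sq hτp _).symm
        _ ≤ ∑ x ∈ box (d := d) P, 2 * (η ^ 2)⁻¹ * (fnorm τ (F (x + e μ)) ^ 2 + fnorm τ (F x) ^ 2) :=
            Finset.sum_le_sum fun x _ => fnorm_covDerivFwd_sq_le τ hτp hτt hτs hUu F μ x
        _ = 4 * (η ^ 2)⁻¹ * formPer τ P f f := by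
            rw [← Finset.mul_sum, Finset.sum_add_distrib, hshift, hff]; ring
    calc ∑ μ : Fin d, ∑ x ∈ box (d := d) P, (τ (star (covDerivFwd η U₀ μ F x) * covDerivFwd η U₀ μ F x)).re
        ≤ ∑ _μ : Fin d, 4 * (η ^ 2)⁻¹ * formPer τ P f f := Finset.sum_le_sum fun μ _ => hμ μ
      _ = 4 * (d : ℝ) * (η ^ 2)⁻¹ * formPer τ P f f := by rw [Finset.sum_const, Finset.card_univ, Fintype.card_fin, nsmul_eq_mul]; ring
  -- penalty
  have hpen : ∑ j ∈ Finset.range (m + 1), ∑ y ∈ box (d := d) (P / L ^ j),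
      (Λs j).indicator (fun y => a j * (τ (star (QprimeIter (zdBlocking d L) (bgT L U₀) j F y) * QprimeIter (zdBlocking d L) (bgT L U₀) j F y)).re) y ≤
        (∑ j ∈ Finset.range (m + 1), a j) * formPer τ P f f := by
    rw [Finset.sum_mul]
    refine Finset.sum_le_sum fun j hj => ?_
    have hjm : j ≤ m := Nat.lt_succ_iff.1 (Finset.mem_range.1 hj)
    haveI : NeZero (L ^ j) := ⟨pow_ne_zero j (NeZero.ne L)⟩
    have htile : ∑ y ∈ box (d := d) (P / L ^ j), ∑ x ∈ blockSites (L ^ j) y, fnorm τ (F x) ^ 2 = formPer τ P f f := by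
      rw [hff, eq_pow_mul_div_of_dvd hP hjm, box_mul_eq_biUnion_blockSites (L ^ j) (P / L ^ j),
        Finset.sum_biUnion (pairwiseDisjoint_blockSites (L ^ j) _), Nat.mul_div_cancel_left _ (pow_pos (Nat.pos_of_ne_zero (NeZero.ne L)) j)]
    have hLdj : (((L : ℝ) ^ d) ^ j)⁻¹ ≤ 1 := by
      have h1 : (1 : ℝ) ≤ ((L : ℝ) ^ d) ^ j := one_le_pow₀ (one_le_pow₀ (by exact_mod_cast hL))
      exact inv_le_one_of_one_le₀ h1
    have hpt : ∀ y : Site d, (Λs j).indicator (fun y => a j * (τ (star (QprimeIter (zdBlocking d L) (bgT L U₀) j F y) *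
        QprimeIter (zdBlocking d L) (bgT L U₀) j F y)).re) y ≤ a j * ∑ x ∈ blockSites (L ^ j) y, fnorm τ (F x) ^ 2 := by
      intro y
      have hS : 0 ≤ ∑ x ∈ blockSites (L ^ j) y, fnorm τ (F x) ^ 2 := Finset.sum_nonneg fun _ _ => sq_nonneg _
      by_cases hy : y ∈ Λs j
      · rw [Set.indicator_of_mem hy, ← fnorm_sq hτp]
        refine mul_le_mul_of_nonneg_left ?_ (ha j)
        refine (fnorm_QprimeIter_sq_le_blockSum τ hτp hτt hτs F (fun i hi => hT i ((le_of_lt hi).trans hjm)) y).trans ?_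
        exact (mul_le_mul_of_nonneg_right hLdj hS).trans (by rw [one_mul])
      · rw [Set.indicator_of_notMem hy]
        exact mul_nonneg (ha j) hS
    calc ∑ y ∈ box (d := d) (P / L ^ j), (Λs j).indicator (fun y => a j * (τ (star (QprimeIter (zdBlocking d L) (bgT L U₀) j F y) *
          QprimeIter (zdBlocking d L) (bgT L U₀) j F y)).re) y
        ≤ ∑ y ∈ box (d := d) (P / L ^ j), a j * ∑ x ∈ blockSites (L ^ j) y, fnorm τ (F x) ^ 2 := Finset.sum_le_sum fun y _ => hpt y
      _ = a j * formPer τ P f f := by rw [← Finset.mul_sum, htile]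
  calc _ ≤ 4 * (d : ℝ) * (η ^ 2)⁻¹ * formPer τ P f f + (∑ j ∈ Finset.range (m + 1), a j) * formPer τ P f f := add_le_add hgrad hpen
    _ = (4 * (d : ℝ) * (η ^ 2)⁻¹ + ∑ j ∈ Finset.range (m + 1), a j) * formPer τ P f f := by ring

include hτp hτt hτs in
/-- ★★ **THE OPERATOR BOUND ON THE TORUS: `⟨Δ′_a(U₀)f, Δ′_a(U₀)f⟩_{T_P} ≤ Θ²·⟨f, f⟩_{T_P}`** (same hypotheses, Hermitian `τ`) — Cauchy–Schwarz for the non-negative symmetric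
form `B(u, v) = ⟨u, Δ′_a v⟩`: `⟨Δ′f, Δ′f⟩² = B(Δ′f, f)² ≤ B(Δ′f, Δ′f)·B(f, f) ≤ Θ⟨Δ′f, Δ′f⟩·Θ⟨f, f⟩`.
[cite: Balaban1985BackgroundPropagators, (3.24) p.394, Thm 3.11 p.416; Balaban1984PropagatorsII, (2.22) p.226] -/
theorem formPer_deltaPrimeAPer_sq_le (hL : 1 ≤ L) (hUu : ∀ (x : Site d) (κ : Fin d), U₀ x κ ∈ unitaryUnits 𝔸)
    (hT : ∀ j, j ≤ m → ∀ (z y : Site d), bgT L U₀ j z y ∈ unitaryUnits 𝔸) (hU : IsPeriodic P U₀) (hP : L ^ m ∣ P) (ha : ∀ j, 0 ≤ a j)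
    (f : perSub (𝔸 := 𝔸) (d := d) P) :
    formPer τ P (deltaPrimeAPer L U₀ η m a Λs P f) (deltaPrimeAPer L U₀ η m a Λs P f) ≤
      (4 * (d : ℝ) * (η ^ 2)⁻¹ + ∑ j ∈ Finset.range (m + 1), a j) ^ 2 * formPer τ P f f := by
  set Θ : ℝ := 4 * (d : ℝ) * (η ^ 2)⁻¹ + ∑ j ∈ Finset.range (m + 1), a j with hΘ
  set T := deltaPrimeAPer (𝔸 := 𝔸) (d := d) L U₀ η m a Λs P with hTdef
  -- the form `B(u, v) = ⟨u, Δ′_a v⟩`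
  set B : perSub (𝔸 := 𝔸) (d := d) P →ₗ[ℝ] perSub (𝔸 := 𝔸) (d := d) P →ₗ[ℝ] ℝ := (formPer τ P).compl₂ T with hB
  have hBapp : ∀ u v, B u v = formPer τ P u (T v) := fun u v => by rw [hB, LinearMap.compl₂_apply]
  have hsymm : ∀ u v, B u v = B v u := by
    intro u v
    rw [hBapp, hBapp, hTdef, formPer_deltaPrimeAPer_symm_le τ hτt hτs hUu hT hU hP v u]
  have hnn : ∀ v, 0 ≤ B v v := fun v => by rw [hBapp]; exact formPer_deltaPrimeAPer_self_nonneg_le τ hτt hτp hUu hT hU hP ha v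
  have hCS := sq_le_mul_of_symm_nonneg B hsymm hnn (T f) f
  rw [hBapp, hBapp, hBapp] at hCS
  -- `B(Tf, f) = ⟨Tf, Tf⟩`, `B(Tf, Tf) ≤ Θ⟨Tf, Tf⟩`, `B(f, f) ≤ Θ⟨f, f⟩`
  have hup1 := formPer_deltaPrimeAPer_self_le τ hτp hτt hτs hL hUu hT hU hP ha (T f) (η := η) (a := a) (Λs := Λs)
  have hup2 := formPer_deltaPrimeAPer_self_le τ hτp hτt hτs hL hUu hT hU hP ha f (η := η) (a := a) (Λs := Λs)
  rw [← hTdef, ← hΘ] at hup1 hup2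
  have hx := formPer_self_nonneg' τ hτp (T f)
  have hf := formPer_self_nonneg' τ hτp f
  have hΘ0 : 0 ≤ Θ := by
    have hd0 : (0 : ℝ) ≤ 4 * (d : ℝ) * (η ^ 2)⁻¹ := by positivity
    exact add_nonneg hd0 (Finset.sum_nonneg fun j _ => ha j)
  -- `X² ≤ (ΘX)(Θ‖f‖²)` with `X = ⟨Tf, Tf⟩ ≥ 0`
  have key : formPer τ P (T f) (T f) ^ 2 ≤ (Θ * formPer τ P (T f) (T f)) * (Θ * formPer τ P f f) :=
    hCS.trans (mul_le_mul hup1 hup2 (formPer_deltaPrimeAPer_self_nonneg_le τ hτt hτp hUu hT hU hP ha f) (mul_nonneg hΘ0 hx))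
  by_cases h0 : formPer τ P (T f) (T f) = 0
  · rw [h0]; exact mul_nonneg (sq_nonneg Θ) hf
  · have hpos : 0 < formPer τ P (T f) (T f) := lt_of_le_of_ne hx (Ne.symm h0)
    have h2 : formPer τ P (T f) (T f) * formPer τ P (T f) (T f) ≤ (Θ ^ 2 * formPer τ P f f) * formPer τ P (T f) (T f) := by nlinarith [key]
    exact le_of_mul_le_mul_right h2 hpos

include hτp hτt hτs in
/-- ★ **`G′(U₀)` IS BOUNDED BELOW: `⟨v, v⟩_{T_P} ≤ Θ²·⟨G′v, G′v⟩_{T_P}`** in the regime (`Δ′_a G′ v = v` and the operator bound at `f = G′v`).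
[cite: Balaban1985BackgroundPropagators, (3.24)–(3.25) p.394, Thm 3.11 p.416] -/
theorem formPer_self_le_sq_mul_formPer_GpPer (hL : 1 ≤ L) (hUu : ∀ (x : Site d) (κ : Fin d), U₀ x κ ∈ unitaryUnits 𝔸)
    (hT : ∀ j, j ≤ m → ∀ (z y : Site d), bgT L U₀ j z y ∈ unitaryUnits 𝔸) (hU : IsPeriodic P U₀) (hP : L ^ m ∣ P) (ha : ∀ j, 0 ≤ a j)
    (hreg : RegularPrimePer L U₀ η m a Λs P) (v : perSub (𝔸 := 𝔸) (d := d) P) :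
    formPer τ P v v ≤ (4 * (d : ℝ) * (η ^ 2)⁻¹ + ∑ j ∈ Finset.range (m + 1), a j) ^ 2 *
      formPer τ P (GpPer L U₀ η m a Λs P v) (GpPer L U₀ η m a Λs P v) := by
  have h := formPer_deltaPrimeAPer_sq_le τ hτp hτt hτs hL hUu hT hU hP ha (GpPer L U₀ η m a Λs P v) (η := η) (Λs := Λs)
  rwa [deltaPrimeAPer_GpPer hreg] at h

end Upper

/-! ## §3  The isometry `⟨Q′*φ, Q′*φ⟩_{T_P} = (Lᵈ)^{−j₀}⟨φ, φ⟩_{𝔅_P}` at one active level -/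

section Isometry

variable {P L : ℕ} [NeZero P] [NeZero L] {U₀ : Site d → Fin d → 𝔸ˣ} {m : ℕ} {Λs : ℕ → Set (Site d)}

include hτp hτt in
/-- ★★ **`Q′*` IS A WEIGHTED ISOMETRY AT THE TORUS MEMBERS**: if the constraint sets are empty at the representatives for every level `j ≠ j₀` (`j ≤ m`; one active level
`j₀ ≤ m`), `Lᵐ ∣ P`, and `Ū₀ʲ(Γ)` is unitary for `j < j₀`, then `⟨Q′*φ, Q′*φ⟩_{T_P} = (Lᵈ)^{−j₀}·⟨φ, φ⟩_{𝔅_P}` for every `φ ∈ L²(𝔅_P, ·)` — `Q′*φ = Q′_{j₀}ᵀφ_{j₀}`, a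
fibrewise `(Lᵈ)^{−j₀}`-scaled unitary conjugation of `φ_{j₀}(blockMap^{j₀}x)`, and each level-`j₀` block has `(Lᵈ)^{j₀}` sites.
[cite: Balaban1985BackgroundPropagators, (3.19) p.393, (3.25) p.394; Balaban1985RegularSpaces, (1.28) p.81, p.77 («Ω_j = T_η»)] -/
theorem formPer_QprimeStarPer_self_eq_of_single_level (hP : L ^ m ∣ P) {j₀ : ℕ} (hj₀ : j₀ ≤ m)
    (hoff : ∀ j, j ≤ m → j ≠ j₀ → ∀ y : Site d, ¬ InSat P L Λs j y)
    (hT : ∀ i, i < j₀ → ∀ z y : Site d, bgT L U₀ i z y ∈ unitaryUnits 𝔸) (φ : levPer (𝔸 := 𝔸) (d := d) P L m Λs) :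
    formPer τ P (QprimeStarPer P L U₀ m Λs φ) (QprimeStarPer P L U₀ m Λs φ) =
      (((L : ℝ) ^ d) ^ j₀)⁻¹ * levFormPer τ P L m Λs φ φ := by
  classical
  haveI : NeZero (L ^ j₀) := ⟨pow_ne_zero j₀ (NeZero.ne L)⟩
  have hL0 : (0 : ℝ) < (L : ℝ) := by exact_mod_cast Nat.pos_of_ne_zero (NeZero.ne L)
  -- the levels `j ≠ j₀` of `φ` vanish identically
  have hzero : ∀ j, j ≠ j₀ → (fun y => (φ : ℕ × Site d → 𝔸) (j, y)) = fun _ => (0 : 𝔸) := by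
    intro j hj
    funext y
    by_cases hjm : j ≤ m
    · exact φ.2.2 (j, y) (fun h => hoff j hjm hj y h.2)
    · exact φ.2.2 (j, y) (fun h => hjm h.1)
  -- `Q′*φ` on the cell is `Q′_{j₀}ᵀφ_{j₀}`
  have hcoe : ∀ x ∈ box (d := d) P, ((QprimeStarPer P L U₀ m Λs φ : perSub (𝔸 := 𝔸) (d := d) P) : Site d → 𝔸) x =
      QprimeT L U₀ j₀ (fun y => (φ : ℕ × Site d → 𝔸) (j₀, y)) x := by
    intro x hx
    rw [QprimeStarPer_coe_apply_of_mem_box P L U₀ m Λs φ hx, QT]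
    rw [Finset.sum_eq_single_of_mem j₀ (Finset.mem_range.2 (Nat.lt_succ_of_le hj₀))]
    · simp only [Set.indicator_univ]
    · intro j _ hj
      simp only [Set.indicator_univ]
      rw [hzero j hj]
      exact QprimeT_zero_fun j x
  -- pointwise norm on the cell
  have hpt : ∀ x ∈ box (d := d) P, fnorm τ (((QprimeStarPer P L U₀ m Λs φ : perSub (𝔸 := 𝔸) (d := d) P) : Site d → 𝔸) x) ^ 2 =
      ((((L : ℝ) ^ d)⁻¹) ^ j₀) ^ 2 * fnorm τ ((φ : ℕ × Site d → 𝔸) (j₀, blockMapIter L j₀ x)) ^ 2 := by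
    intro x hx
    rw [hcoe x hx, fnorm_QprimeT_eq τ hτt j₀ hT _ x, mul_pow]
  -- the cell sum, tiled by the level-`j₀` blocks
  rw [formPer_apply, levFormPer_apply]
  have hlhs : ∑ x ∈ box (d := d) P, (τ (star (((QprimeStarPer P L U₀ m Λs φ : perSub (𝔸 := 𝔸) (d := d) P) : Site d → 𝔸) x) *
      ((QprimeStarPer P L U₀ m Λs φ : perSub (𝔸 := 𝔸) (d := d) P) : Site d → 𝔸) x)).re =
      ((((L : ℝ) ^ d)⁻¹) ^ j₀) ^ 2 * ∑ y ∈ box (d := d) (P / L ^ j₀), ∑ x ∈ blockSites (L ^ j₀) y,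
        fnorm τ ((φ : ℕ × Site d → 𝔸) (j₀, blockMapIter L j₀ x)) ^ 2 := by
    have hbox : box (d := d) P = (box (d := d) (P / L ^ j₀)).biUnion (blockSites (L ^ j₀)) :=
      box_eq_biUnion_blockSites_of_dvd (L ^ j₀) ((pow_dvd_pow L hj₀).trans hP)
    rw [Finset.mul_sum, hbox, Finset.sum_biUnion (pairwiseDisjoint_blockSites (L ^ j₀) _)]
    refine Finset.sum_congr rfl fun y hy => ?_
    rw [Finset.mul_sum]
    refine Finset.sum_congr rfl fun x hx => ?_
    have hxP : x ∈ box (d := d) P := by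
      rw [hbox, Finset.mem_biUnion]
      exact ⟨y, hy, hx⟩
    rw [← fnorm_sq hτp, hpt x hxP]
  rw [hlhs]
  -- on the block `Bʲ⁰(y)`, `blockMap^{j₀} x = y`; the block has `(Lᵈ)^{j₀}` sites
  have hblock : ∀ y : Site d, ∑ x ∈ blockSites (L ^ j₀) y, fnorm τ ((φ : ℕ × Site d → 𝔸) (j₀, blockMapIter L j₀ x)) ^ 2 =
      ((L : ℝ) ^ d) ^ j₀ * fnorm τ ((φ : ℕ × Site d → 𝔸) (j₀, y)) ^ 2 := by
    intro y
    rw [Finset.sum_congr rfl fun x hx => by rw [(mem_blockSites_pow_iff j₀ y x).1 hx], Finset.sum_const, card_blockSites, nsmul_eq_mul]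
    push_cast
    rw [← pow_mul, ← pow_mul, mul_comm j₀ d]
  simp only [hblock]
  rw [← Finset.mul_sum, ← mul_assoc]
  have hc : ((((L : ℝ) ^ d)⁻¹) ^ j₀) ^ 2 * ((L : ℝ) ^ d) ^ j₀ = (((L : ℝ) ^ d) ^ j₀)⁻¹ := by
    rw [inv_pow, sq, mul_assoc, inv_mul_cancel₀ (by positivity), mul_one]
  rw [hc]
  congr 1
  -- the level form: only the level `j₀` contributes
  rw [Finset.sum_eq_single_of_mem j₀ (Finset.mem_range.2 (Nat.lt_succ_of_le hj₀))]
  · exact Finset.sum_congr rfl fun y _ => fnorm_sq hτp _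
  · intro j _ hj
    refine Finset.sum_eq_zero fun y _ => ?_
    have h0 : (φ : ℕ × Site d → 𝔸) (j, y) = 0 := by simpa using congrFun (hzero j hj) y
    rw [h0, mul_zero, map_zero, Complex.zero_re]

end Isometry

/-! ## §4  The explicit coercivity of `Q′G′(U₀)²Q′*` and the bound of `(Q′G′²Q′*)⁻¹` on the torus -/

section QGGQ

variable {P L : ℕ} [NeZero P] [NeZero L] {η : ℝ} {U₀ : Site d → Fin d → 𝔸ˣ} {m : ℕ} {a : ℕ → ℝ} {Λs : ℕ → Set (Site d)}

include hτp hτt hτs in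
/-- ★★★ **AN EXPLICIT COERCIVITY CONSTANT FOR `Q′G′(U₀)²Q′*` ON THE TORUS**: in the regime (`Δ′_a(U₀)` invertible), at a unitary `P`-periodic `U₀` with `Ū₀ʲ(Γ)` unitary for
`j ≤ m`, `Lᵐ ∣ P`, `a ≥ 0`, `1 ≤ L`, one active level `j₀ ≤ m`: `((Lᵈ)^{j₀}·Θ²)⁻¹·⟨φ, φ⟩_{𝔅_P} ≤ ⟨φ, Q′G′(U₀)²Q′*φ⟩_{𝔅_P}`, `Θ = 4d∕η² + Σ_{j≤m} a_j` —
`⟨φ, Q′G′²Q′*φ⟩ = ‖G′Q′*φ‖² ≥ Θ⁻²‖Q′*φ‖² = Θ⁻²(Lᵈ)^{−j₀}‖φ‖²`. [cite: Balaban1985BackgroundPropagators, (3.25) p.394, Thm 3.11 p.416 («(Q′G′²Q′*)⁻¹ … positive definite»); Balaban1984PropagatorsII, (2.22) p.226] -/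
theorem coercive_levFormPer_qggqPer_explicit (hL : 1 ≤ L) (hUu : ∀ (x : Site d) (κ : Fin d), U₀ x κ ∈ unitaryUnits 𝔸)
    (hT : ∀ j, j ≤ m → ∀ (z y : Site d), bgT L U₀ j z y ∈ unitaryUnits 𝔸) (hU : IsPeriodic P U₀) (hP : L ^ m ∣ P) (ha : ∀ j, 0 ≤ a j)
    (hreg : RegularPrimePer L U₀ η m a Λs P) {j₀ : ℕ} (hj₀ : j₀ ≤ m) (hoff : ∀ j, j ≤ m → j ≠ j₀ → ∀ y : Site d, ¬ InSat P L Λs j y)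
    (φ : levPer (𝔸 := 𝔸) (d := d) P L m Λs) :
    (((L : ℝ) ^ d) ^ j₀ * (4 * (d : ℝ) * (η ^ 2)⁻¹ + ∑ j ∈ Finset.range (m + 1), a j) ^ 2)⁻¹ * levFormPer τ P L m Λs φ φ ≤
      levFormPer τ P L m Λs φ (qggqPer P L U₀ η m a Λs φ) := by
  set Θ : ℝ := 4 * (d : ℝ) * (η ^ 2)⁻¹ + ∑ j ∈ Finset.range (m + 1), a j with hΘ
  have hL0 : (0 : ℝ) < (L : ℝ) := by exact_mod_cast Nat.pos_of_ne_zero (NeZero.ne L)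
  have hLd : (0 : ℝ) < ((L : ℝ) ^ d) ^ j₀ := by positivity
  rw [levFormPer_qggqPer_self_le τ hτt hτs hUu hT hU hP hreg φ]
  have h1 := formPer_self_le_sq_mul_formPer_GpPer τ hτp hτt hτs hL hUu hT hU hP ha hreg (QprimeStarPer P L U₀ m Λs φ) (η := η) (Λs := Λs)
  rw [← hΘ] at h1
  rw [formPer_QprimeStarPer_self_eq_of_single_level τ hτp hτt hP hj₀ hoff (fun i hi => hT i ((le_of_lt hi).trans hj₀)) φ] at h1
  -- `h1 : (Lᵈʲ⁰)⁻¹⟨φ,φ⟩ ≤ Θ²·⟨G′Q′*φ, G′Q′*φ⟩`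
  have hφ : 0 ≤ levFormPer τ P L m Λs φ φ := B9Eq325QGGQInvZdPer.levFormPer_self_nonneg τ P L m Λs hτp φ
  have hG : 0 ≤ formPer τ P (GpPer L U₀ η m a Λs P (QprimeStarPer P L U₀ m Λs φ)) (GpPer L U₀ η m a Λs P (QprimeStarPer P L U₀ m Λs φ)) :=
    formPer_self_nonneg' τ hτp _
  by_cases hΘ0 : Θ = 0
  · -- then `(Lᵈʲ⁰)⁻¹⟨φ,φ⟩ ≤ 0`, so `⟨φ,φ⟩ = 0` and the claim is `0 ≤ …`
    rw [hΘ0] at h1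
    have hφ0 : levFormPer τ P L m Λs φ φ = 0 := by
      have : (((L : ℝ) ^ d) ^ j₀)⁻¹ * levFormPer τ P L m Λs φ φ ≤ 0 := by simpa using h1
      have hinv : 0 < (((L : ℝ) ^ d) ^ j₀)⁻¹ := inv_pos.2 hLd
      nlinarith [mul_nonneg hinv.le hφ]
    rw [hφ0, mul_zero]
    exact hG
  · have hΘpos : 0 < Θ ^ 2 := by positivity
    rw [mul_inv, mul_comm ((((L : ℝ) ^ d) ^ j₀)⁻¹) _, mul_assoc, inv_mul_le_iff₀ hΘpos]
    exact h1

include hτp hτt hτs in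
/-- ★★ **THE EXPLICIT BOUND FOR `c(U₀) = (Q′G′²Q′*)⁻¹` ON THE TORUS**: under the hypotheses of `coercive_levFormPer_qggqPer_explicit` (`0 < d`, `η ≠ 0`, finite-dimensional fibre),
`⟨cφ, cφ⟩_{𝔅_P} ≤ ((Lᵈ)^{j₀}Θ²)²·⟨φ, φ⟩_{𝔅_P}` — `B9Thm311InverseL2BoundsZdPer.levFormPer_cPer_self_le_of_coercive` fed with the explicit constant (`Q′G′²Q′*` bijective by
the levels edition, `Q′*` injective at one active level). [cite: Balaban1985BackgroundPropagators, Thm 3.11 p.416, (3.25) p.394; Balaban1984PropagatorsII, (2.22) p.226] -/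
theorem levFormPer_cPer_self_le_explicit [FiniteDimensional ℝ 𝔸] (hd : 0 < d) (hL : 1 ≤ L) (hη : η ≠ 0)
    (hUu : ∀ (x : Site d) (κ : Fin d), U₀ x κ ∈ unitaryUnits 𝔸)
    (hT : ∀ j, j ≤ m → ∀ (z y : Site d), bgT L U₀ j z y ∈ unitaryUnits 𝔸) (hU : IsPeriodic P U₀) (hP : L ^ m ∣ P) (ha : ∀ j, 0 ≤ a j)
    (hreg : RegularPrimePer L U₀ η m a Λs P) {j₀ : ℕ} (hj₀ : j₀ ≤ m) (hoff : ∀ j, j ≤ m → j ≠ j₀ → ∀ y : Site d, ¬ InSat P L Λs j y)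
    (φ : levPer (𝔸 := 𝔸) (d := d) P L m Λs) :
    levFormPer τ P L m Λs (cPer P L U₀ η m a Λs φ) (cPer P L U₀ η m a Λs φ) ≤
      (((L : ℝ) ^ d) ^ j₀ * (4 * (d : ℝ) * (η ^ 2)⁻¹ + ∑ j ∈ Finset.range (m + 1), a j) ^ 2) ^ 2 * levFormPer τ P L m Λs φ φ := by
  have hinj : QprimeStarPerInjective (𝔸 := 𝔸) (d := d) P L U₀ m Λs := qprimeStarPerInjective_of_single_level hP hj₀ hoff
  have hb := qggqPer_bijective_le τ hτt hτs hτp hUu hT hU hP hreg hinj (η := η) (a := a)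
  have hL0 : (0 : ℝ) < (L : ℝ) := by exact_mod_cast Nat.pos_of_ne_zero (NeZero.ne L)
  have hdpos : (0 : ℝ) < d := by exact_mod_cast hd
  have hη2 : 0 < (η ^ 2)⁻¹ := inv_pos.2 (by positivity)
  have hΘ : 0 < 4 * (d : ℝ) * (η ^ 2)⁻¹ + ∑ j ∈ Finset.range (m + 1), a j := by
    have : 0 < 4 * (d : ℝ) * (η ^ 2)⁻¹ := by positivity
    linarith [Finset.sum_nonneg fun j (_ : j ∈ Finset.range (m + 1)) => ha j]
  have hc : 0 < (((L : ℝ) ^ d) ^ j₀ * (4 * (d : ℝ) * (η ^ 2)⁻¹ + ∑ j ∈ Finset.range (m + 1), a j) ^ 2)⁻¹ := by positivity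
  have h := levFormPer_cPer_self_le_of_coercive τ hτp hτs hb hc
    (fun ψ => coercive_levFormPer_qggqPer_explicit τ hτp hτt hτs hL hUu hT hU hP ha hreg hj₀ hoff ψ) φ
  rwa [inv_inv] at h

include hτp hτt hτs in
/-- ★★ **AT THE TORUS MEMBER OF RECORD** (`Λ_j = torusLam m j`: none below `m`, every top-level site): the one-active-level hypothesis holds with `j₀ = m` and NO geometric
condition, so `((Lᵈ)^m·Θ²)⁻¹·⟨φ, φ⟩ ≤ ⟨φ, Q′G′(U₀)²Q′*φ⟩` in the regime at every unitary periodic `U₀` with `Ū₀ʲ(Γ)` unitary for `j ≤ m`.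
[cite: Balaban1985BackgroundPropagators, (3.25) p.394, Thm 3.11 p.416; Balaban1985RegularSpaces, (1.28) p.81, (1.37) p.82] -/
theorem coercive_levFormPer_qggqPer_torusLam (hL : 1 ≤ L) (hUu : ∀ (x : Site d) (κ : Fin d), U₀ x κ ∈ unitaryUnits 𝔸)
    (hT : ∀ j, j ≤ m → ∀ (z y : Site d), bgT L U₀ j z y ∈ unitaryUnits 𝔸) (hU : IsPeriodic P U₀) (hP : L ^ m ∣ P) (ha : ∀ j, 0 ≤ a j)
    (hreg : RegularPrimePer L U₀ η m a (B8Thm4TorusAt.torusLam (d := d) m) P)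
    (φ : levPer (𝔸 := 𝔸) (d := d) P L m (B8Thm4TorusAt.torusLam (d := d) m)) :
    (((L : ℝ) ^ d) ^ m * (4 * (d : ℝ) * (η ^ 2)⁻¹ + ∑ j ∈ Finset.range (m + 1), a j) ^ 2)⁻¹ *
        levFormPer τ P L m (B8Thm4TorusAt.torusLam (d := d) m) φ φ ≤
      levFormPer τ P L m (B8Thm4TorusAt.torusLam (d := d) m) φ (qggqPer P L U₀ η m a (B8Thm4TorusAt.torusLam (d := d) m) φ) := by
  refine coercive_levFormPer_qggqPer_explicit τ hτp hτt hτs hL hUu hT hU hP ha hreg le_rfl (fun j _ hjm y hsat => hjm ?_) φ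
  unfold B9Eq325QGGQInvZdPer.InSat at hsat
  rw [B8Thm4TorusAt.mem_torusLam_iff] at hsat
  exact hsat

end QGGQ

/-! ## §5  On the small-field class of the torus: no regime hypothesis left -/

section Class

variable [Nontrivial 𝔸] [FiniteDimensional ℝ 𝔸]
  {P L : ℕ} [NeZero P] [NeZero L] {η : ℝ} {U₀ : Site d → Fin d → 𝔸ˣ} {m k : ℕ} {a : ℕ → ℝ} {Λs : ℕ → Set (Site d)}

open B7Prop2Explicit (pdev C0 c2')
open B9Thm31NearFlatTransportersZd (bgT_mem_unitaryUnits_of_pdev)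
open B9Thm31NearFlatCoerciveClassZdPer (regularPrimePer_of_class)

include hτp hτt hτs in
/-- ★★★ **THE EXPLICIT COERCIVITY OF `Q′G′(U₀)²Q′*` AT EVERY BACKGROUND OF THE SMALL-FIELD CLASS OF THE TORUS** — the regime hypothesis of §4 DISCHARGED by
`B9Thm31NearFlatCoerciveClassZdPer.regularPrimePer_of_class` and the transporters' unitarity by [B7] Prop. 2 (`bgT_mem_unitaryUnits_of_pdev`, `m ≤ k`): for a unitary
`P`-periodic `U₀` with `‖U₀(b) − 1‖ ≤ θ′η`, `pdev U₀ < α₀(L^k)^{−2}`, `2 ≤ L`, `m ≤ k`, the weight hypotheses, a flat coercivity `a₀` and a positive margin, one active level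
`j₀ ≤ m`: `((Lᵈ)^{j₀}Θ²)⁻¹·⟨φ, φ⟩_{𝔅_P} ≤ ⟨φ, Q′G′(U₀)²Q′*φ⟩_{𝔅_P}`.
[cite: Balaban1985BackgroundPropagators, Thm 3.11 p.416 («uniformly in U»), (3.25) p.394, (3.35) p.396; Balaban1985Averaging, Prop. 2 p.26; Balaban1984PropagatorsII, (2.22) p.226] -/
theorem coercive_levFormPer_qggqPer_of_class {Cu Cl : ℝ} (hCu : ∀ b : 𝔸, fnorm τ b ≤ Cu * ‖b‖) (hCl : ∀ b : 𝔸, ‖b‖ ≤ Cl * fnorm τ b)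
    (hCu0 : 0 ≤ Cu) (hCl0 : 0 ≤ Cl) (hL : 2 ≤ L) (hη : 0 < η) (hUu : ∀ (x : Site d) (κ' : Fin d), U₀ x κ' ∈ unitaryUnits 𝔸) (hU : IsPeriodic P U₀)
    {θ' : ℝ} (hθ' : 0 ≤ θ') (hR : ∀ (x : Site d) (μ : Fin d), ‖((U₀ x μ : 𝔸ˣ) : 𝔸) - 1‖ ≤ θ' * η)
    {α₀ : ℝ} (hα : 0 < α₀) (hα3 : C0 d * α₀ ≤ 1 / 3) (hα2 : 2 * α₀ ≤ c2' d L) (h52 : pdev U₀ < α₀ * (((L : ℝ) ^ k)⁻¹) ^ 2)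
    (hm : m ≤ k) (hkη : ((L : ℝ) ^ k)⁻¹ ≤ η) (hηL : ∀ j ∈ Finset.range (m + 1), η * (L : ℝ) ^ j ≤ 1)
    (ha : ∀ j, 0 ≤ a j) {A : ℝ} (haA : ∀ j ∈ Finset.range (m + 1), a j * η ^ 2 * ((L : ℝ) ^ j) ^ 2 ≤ A * ((L : ℝ) ^ j) ^ d) (hP : L ^ m ∣ P)
    {a₀ : ℝ} (hco : ∀ f : perSub (𝔸 := 𝔸) (d := d) P, a₀ * formPer τ P f f ≤ formPer τ P f (deltaPrimeAPer L (1 : Site d → Fin d → 𝔸ˣ) η m a Λs P f))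
    (hmargin : (2 * Cu * Cl) ^ 2 * (d * θ' ^ 2 + A * d ^ 2 * (L : ℝ) ^ 2 * (256 * (d + 1) * (d + 4) * α₀ + θ') ^ 2 * (m + 1)) < a₀ / 2)
    {j₀ : ℕ} (hj₀ : j₀ ≤ m) (hoff : ∀ j, j ≤ m → j ≠ j₀ → ∀ y : Site d, ¬ InSat P L Λs j y) (φ : levPer (𝔸 := 𝔸) (d := d) P L m Λs) :
    (((L : ℝ) ^ d) ^ j₀ * (4 * (d : ℝ) * (η ^ 2)⁻¹ + ∑ j ∈ Finset.range (m + 1), a j) ^ 2)⁻¹ * levFormPer τ P L m Λs φ φ ≤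
      levFormPer τ P L m Λs φ (qggqPer P L U₀ η m a Λs φ) := by
  have hreg : RegularPrimePer L U₀ η m a Λs P :=
    regularPrimePer_of_class τ hτp hτt hτs hCu hCl hCu0 hCl0 hL hη hUu hU hθ' hR hα hα3 hα2 h52 hm hkη hηL ha haA hP hco hmargin
  have hT : ∀ j, j ≤ m → ∀ z y : Site d, bgT L U₀ j z y ∈ unitaryUnits 𝔸 :=
    fun j hj z y => bgT_mem_unitaryUnits_of_pdev hL k hUu hα hα3 hα2 h52 (hj.trans hm) z y
  exact coercive_levFormPer_qggqPer_explicit τ hτp hτt hτs (le_trans (by norm_num) hL) hUu hT hU hP ha hreg hj₀ hoff φ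

end Class

end Literature.MathematicalPhysics.QuantumFieldTheory.Balaban1983to89.B9Eq325QGGQCoerciveExplicitZdPer
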